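/-
Copyright (c) 2026 the pub-hodgecm-mathlib formalisation cell (harness21).  Prover seat hodgecm-mathlib-LH4-p04 (g2), req620 Track A «(D-RAM) FOUR-FRAME» squad
(MS ROAD A, STAGE B bricks B3∕B3₂ — the axis vector of an HNF lattice from its three exponents `(b + (c ∸ w), b + (c ∸ m), c)`, both vertex types at once).  2026-09-04.
-/
import Summits.HodgeConjecture.HodgeConjecture.Theorems.F0P3cDyRamDiagonalStrataShapes   -- ★ part 4 (this seat): `hasAxis_of_three`, `mul_exp_le_exp_iff`; brings ★ StrataDefs (`HasAxis`), ★ B2 (`single_*_mem_latt_hnf_pow_iff`)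
import HarnessLib

/-!
# Crux `H413`, line LH4 «(D-RAM) FOUR-FRAME» road — unit U3_Laws (iii), MS ROAD A, STAGE B: THE AXIS VECTOR OF AN HNF LATTICE FROM ITS EXPONENTS — for `|x| = 1`, `|z| = |ϖ|^m`,
# `|xz − yϖ^b| = |ϖ|^w` the lattice `(1 0 0; x ϖ^b 0; y z ϖ^c)·𝒪³` has axis vector `(b + (c ∸ w), b + (c ∸ m), c)` (truncated subtraction) — every glued ∕ hanging stratum of BOTH types at once

Cell `hodgecm-mathlib` (D-0151), FLOOR 0, crux item H413 = `stmt-HodgeConjecture-24833`, route of record `HCCMUnconditional`; squad F0∕P3c∕LH4 (req618∕req620); registered stub served: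
`F0P3cDyRamFourFrameU3.stub_U3_stableModelSum` (MS).  THEOREMS ONLY (no `def`, no instance, no notation, no `sorry`, default heartbeats); lane
`--supports stmt-HodgeConjecture-24833 --as helper` (count-neutral).  ★ part 4 (`F0P3cDyRamDiagonalStrataShapes`) read the axis vectors of the eight TYPE-0 strata one by one; the
type-2 strata of ★ part 6b (`typeTwo_sieve`: G₁ `c = 2ρ+1+s`, H `c = 2ρ+1`, G₂, G₃ and the `r = 1` feet) have the same HNF shape with `c` shifted by one, so this file proves the
GENERAL exponent formula once (LH4-p10 (g2) MEMO v2 §1: `a₂ = c`, `a₁ = b + max(0, c − v z)`, `a₀ = max(b, b + c − v(xz − yϖ^b))`), of which all of them — and ★ part 4's G₁∕G₂∕G₃∕H — are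
instances; the B3₂ shape list (part 7) reads its axis vectors from here.

THE MATHEMATICS.  ★ B2 (p855755): `t·e₂ ∈ latt V ↔ |t| ≤ |ϖ|^c`; `t·e₁ ∈ latt V ↔ |t| ≤ |ϖ|^b ∧ |tz| ≤ |ϖ|^{b+c}`; `t·e₀ ∈ latt V ↔ |t| ≤ 1 ∧ |tx| ≤ |ϖ|^b ∧ |t(yϖ^b − xz)| ≤ |ϖ|^{b+c}`.
With `|z| = |ϖ|^m` the middle criterion is `|t| ≤ min(|ϖ|^b, |ϖ|^{b+c−m}) = |ϖ|^{b + (c ∸ m)}`; with `|x| = 1`, `|yϖ^b − xz| = |ϖ|^w` the first is `|t| ≤ |ϖ|^{b + (c ∸ w)}`.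

WHAT IS PROVED.  §1 `le_exp_and_mul_exp_le_iff_min` (`(a ≤ exp k ∧ a·exp m ≤ exp n) ↔ a ≤ exp(min k (n − m))`), `le_exp_and_le_exp_and_mul_exp_le_iff_min`.  §2 HEAD
`hasAxis_latt_hnf_of_exponents`: `HasAxis ϖ (latt V) ![b + (c - w), b + (c - m), c]` (ℕ subtraction; `|x| = 1`), and `hasAxis_latt_hnf_of_exponents_zero` (`b = 0`, any integral `x`).
HONEST LABEL.  Count-neutral (`--supports`); nothing printed is asserted; (MS) stays a PROVER TARGET (empirical census law — MEMO v2∕v2.1 is its paper proof); `HC_CM` is proved only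
modulo the 7 printed citations (2 remaining named inputs: hLiu418 = `stmt-HodgeConjecture-24832`, h413 = `stmt-HodgeConjecture-24833`) until rung 0 closes.

## References
* [Serre1980Trees] J.-P. Serre, *Trees*, Springer (1980), Ch. II §1.1 (lattices, Hermite normal forms, coordinate axes).
* [BruhatTits1972] F. Bruhat, J. Tits, *Groupes réductifs sur un corps local I*, Publ. Math. IHÉS 41 (1972), §10 (apartments: distance to the splitting sub-buildings).
* [Kottwitz1986BaseChangeUnits] R. E. Kottwitz, *Base change for unit elements of Hecke algebras*, Compositio Math. 60 (1986), §1 pp. 240–241.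
-/

set_option autoImplicit false

noncomputable section

namespace Summit.HodgeConjecture.HodgeConjecture.Cruxes.H413.F0P3cDyRamDiagonalHNFAxisOfExponents

open Matrix
open Literature.NumberTheory.Automorphic Literature.NumberTheory.Automorphic.HermitianLattice
open Literature.NumberTheory.Automorphic.UnitaryLatticeTree
open Summit.HodgeConjecture.HodgeConjecture.Cruxes.H413.F0P3cDyRamDiagonalStrataDefs
open Summit.HodgeConjecture.HodgeConjecture.Cruxes.H413.F0P3cDyRamDiagonalHNFAxisExponents
open Summit.HodgeConjecture.HodgeConjecture.Cruxes.H413.F0P3cDyRamDiagonalStrataShapes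
open scoped Valued WithZero Matrix MatrixGroups

/-! ## §1  Order bookkeeping in `ℤᵐ⁰` with `min` -/

/-- `exp (min k l) = min (exp k) (exp l)`. [cite: Serre1980Trees, II §1.1] -/
theorem exp_min (k l : ℤ) : WithZero.exp (min k l) = min (WithZero.exp k) (WithZero.exp l) := by
  rcases le_total k l with h | h
  · rw [min_eq_left h, min_eq_left (WithZero.exp_le_exp.2 h)]
  · rw [min_eq_right h, min_eq_right (WithZero.exp_le_exp.2 h)]

/-- `(a ≤ exp k ∧ a·exp m ≤ exp n) ↔ a ≤ exp (min k (n − m))`. [cite: Serre1980Trees, II §1.1] -/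
theorem le_exp_and_mul_exp_le_iff_min (a : ℤᵐ⁰) (k m n : ℤ) :
    (a ≤ WithZero.exp k ∧ a * WithZero.exp m ≤ WithZero.exp n) ↔ a ≤ WithZero.exp (min k (n - m)) := by
  rw [mul_exp_le_exp_iff, exp_min, le_min_iff]

/-- `(a ≤ exp j ∧ a ≤ exp k ∧ a·exp m ≤ exp n) ↔ a ≤ exp (min j (min k (n − m)))`. [cite: Serre1980Trees, II §1.1] -/
theorem le_exp_and_le_exp_and_mul_exp_le_iff_min (a : ℤᵐ⁰) (j k m n : ℤ) :
    (a ≤ WithZero.exp j ∧ a ≤ WithZero.exp k ∧ a * WithZero.exp m ≤ WithZero.exp n) ↔ a ≤ WithZero.exp (min j (min k (n - m))) := by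
  rw [mul_exp_le_exp_iff, exp_min, exp_min, le_min_iff, le_min_iff]

variable {K : Type*} [Field K] [Valued K ℤᵐ⁰]

/-! ## §2  HEAD — the axis vector from the exponents -/

/-- **THE AXIS VECTOR OF AN HNF LATTICE FROM ITS EXPONENTS.**  Let `|ϖ| = exp(−1)`, `V = (1 0 0; x ϖ^b 0; y z ϖ^c)` with `|x| = 1`, `|z| = |ϖ^m|` and `|xz − yϖ^b| = |ϖ^w|`.  Then
`latt V` has axis vector `(b + (c ∸ w), b + (c ∸ m), c)` (ℕ truncated subtraction; = `(max(b, b+c−w), max(b, b+c−m), c)`): every glued∕hanging stratum of BOTH vertex types is an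
instance — type 0 (★ part 2): G₁ `(m, w) = (ρ, ρ+s)`, `c = 2ρ+s` ↦ `(2ρ, 2ρ+s, 2ρ+s)`; H ↦ `(2ρ,2ρ,2ρ)`; G₂ `(ρ+s, ρ)` ↦ `(2ρ+s, 2ρ, 2ρ+s)`; G₃ `c = 2ρ`, `b = ρ+s`, `(ρ, ρ)` ↦
`(2ρ+s, 2ρ+s, 2ρ)`; type 2 (★ part 6b): the same with `c` one larger ↦ `(2ρ+1, 2ρ+1+s, 2ρ+1+s)` etc.  [cite: Serre1980Trees, II §1.1] [cite: BruhatTits1972, §10]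
[cite: Kottwitz1986BaseChangeUnits, §1 pp. 240–241] -/
theorem hasAxis_latt_hnf_of_exponents {ϖ : K} (hϖ : Valued.v ϖ = WithZero.exp (-1 : ℤ)) (b c : ℕ) {m w : ℕ} {x y z : K}
    (hx1 : Valued.v x = 1) (hzm : Valued.v z = Valued.v (ϖ ^ m)) (hw : Valued.v (x * z - y * ϖ ^ b) = Valued.v (ϖ ^ w)) :
    HasAxis ϖ (latt (Matrix.of ![![1, 0, 0], ![x, ϖ ^ b, 0], ![y, z, ϖ ^ c]])) ![b + (c - w), b + (c - m), c] := by
  have hϖ0 : ϖ ≠ 0 := (Valuation.ne_zero_iff Valued.v).1 (by rw [hϖ]; exact WithZero.exp_ne_zero)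
  have hq : ∀ n : ℕ, Valued.v ϖ ^ n = WithZero.exp (-(n : ℤ)) := fun n => by
    rw [hϖ, ← WithZero.exp_nsmul]; congr 1; simp
  rw [map_pow, hq] at hzm
  have hw' : Valued.v (y * ϖ ^ b - x * z) = WithZero.exp (-(w : ℤ)) := by rw [Valuation.map_sub_swap, hw, map_pow, hq]
  refine hasAxis_of_three (fun t => ?_) (fun t => ?_) (fun t => ?_)
  · rw [single_zero_mem_latt_hnf_pow_iff hϖ0, map_mul, hx1, mul_one, map_mul, hw', ← WithZero.exp_zero, hq, hq, hq,
      le_exp_and_le_exp_and_mul_exp_le_iff_min]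
    constructor <;> intro h <;> refine h.trans (WithZero.exp_le_exp.2 (le_of_eq ?_)) <;> push_cast <;> omega
  · rw [single_one_mem_latt_hnf_pow_iff hϖ0, map_mul, hzm, hq, hq, hq, le_exp_and_mul_exp_le_iff_min]
    constructor <;> intro h <;> refine h.trans (WithZero.exp_le_exp.2 (le_of_eq ?_)) <;> push_cast <;> omega
  · rw [single_two_mem_latt_hnf_pow_iff hϖ0]


/-- **THE SAME ON THE BRANCH `b = 0`** (no condition on `x`): for `V = (1 0 0; x 1 0; y z ϖ^c)` with `|x| ≤ 1`, `|z| = |ϖ^m|`, `|xz − y| = |ϖ^w|`, the axis vector is `(c ∸ w, c ∸ m, c)`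
— the `r = 1` feet of ★ part 6b: G₁(1, c−1) `(m, w) = (0, c−1)` ↦ `(1, c, c)`, H(1) `(0,0)`, `c = 1` ↦ `(1,1,1)`, G₂(1, c−1) `(c−1, 0)` ↦ `(c, 1, c)`.
[cite: Serre1980Trees, II §1.1] [cite: BruhatTits1972, §10] -/
theorem hasAxis_latt_hnf_of_exponents_zero {ϖ : K} (hϖ : Valued.v ϖ = WithZero.exp (-1 : ℤ)) (c : ℕ) {m w : ℕ} {x y z : K}
    (hx : Valued.v x ≤ 1) (hzm : Valued.v z = Valued.v (ϖ ^ m)) (hw : Valued.v (x * z - y * ϖ ^ 0) = Valued.v (ϖ ^ w)) :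
    HasAxis ϖ (latt (Matrix.of ![![1, 0, 0], ![x, ϖ ^ 0, 0], ![y, z, ϖ ^ c]])) ![c - w, c - m, c] := by
  have hϖ0 : ϖ ≠ 0 := (Valuation.ne_zero_iff Valued.v).1 (by rw [hϖ]; exact WithZero.exp_ne_zero)
  have hq : ∀ n : ℕ, Valued.v ϖ ^ n = WithZero.exp (-(n : ℤ)) := fun n => by
    rw [hϖ, ← WithZero.exp_nsmul]; congr 1; simp
  rw [map_pow, hq] at hzm
  have hw' : Valued.v (y * ϖ ^ 0 - x * z) = WithZero.exp (-(w : ℤ)) := by rw [Valuation.map_sub_swap, hw, map_pow, hq]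
  refine hasAxis_of_three (fun t => ?_) (fun t => ?_) (fun t => ?_)
  · rw [single_zero_mem_latt_hnf_pow_iff hϖ0, zero_add, map_mul Valued.v t (y * ϖ ^ 0 - x * z), hw', ← WithZero.exp_zero, hq, hq, hq]
    constructor
    · rintro ⟨h1, -, h3⟩
      have h := (le_exp_and_mul_exp_le_iff_min _ _ _ _).1 ⟨h1, h3⟩
      exact h.trans (WithZero.exp_le_exp.2 (le_of_eq (by omega)))
    · intro h
      have h' := (le_exp_and_mul_exp_le_iff_min (Valued.v t) 0 (-(w : ℤ)) (-(c : ℤ))).2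
        (h.trans (WithZero.exp_le_exp.2 (le_of_eq (by omega))))
      refine ⟨h'.1, ?_, h'.2⟩
      rw [map_mul]
      calc Valued.v t * Valued.v x ≤ WithZero.exp 0 * 1 := mul_le_mul' h'.1 hx
        _ = WithZero.exp (-((0 : ℕ) : ℤ)) := by rw [mul_one, Nat.cast_zero, neg_zero]
  · rw [single_one_mem_latt_hnf_pow_iff hϖ0, map_mul, hzm, hq, hq, hq, le_exp_and_mul_exp_le_iff_min]
    constructor <;> intro h <;> refine h.trans (WithZero.exp_le_exp.2 (le_of_eq ?_)) <;> push_cast <;> omega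
  · rw [single_two_mem_latt_hnf_pow_iff hϖ0]

end Summit.HodgeConjecture.HodgeConjecture.Cruxes.H413.F0P3cDyRamDiagonalHNFAxisOfExponents

end
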